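import Mathlib
import HarnessLib
import HarnessLib.Audit
import Summits.QuantumFields.Statement
import Summits.QuantumFields.YangMills.Theses.UnitScaleTilt
import Literature.MathematicalPhysics.QuantumFieldTheory.Balaban1983to89.T3YM3TorusStatement
import HarnessLib.Audit.Status.Attr

/-!
Route: CovariantDischarge

X = the LADDER-UNIFORM SANDWICH WINDOW TAILS of the block-averaged SU(2) plaquette: for every
profile b ≥ b₀ the Gibbs mass of {all finer heights θ(b)-small ∧ ALL CONSTRAINED COARSER heights
θ(Λb)-small ∧ θ(b)(K−j) ≤ dist1(Ū^j(∂p))} is ≤ C·β_(K−j)^N·exp(−c·p_(K−j)(b₀)²) with constants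
independent of b — on a positive FRACTION of the depth (crux SandwichFractionalWindowTailL, the
covariant Cameron–Martin sweep's REPAIRED target after the LEAD's located hazard ✓p658705: the
coarse conjunct excludes the locally-uniform-excess configurations and bounds the far c-weighted
mean) and on the deep heights (RESIDUAL SandwichDeepWindowTailL, organ-class); a severity-maximal
EXACT re-cover of the bad-history event (support HistoryTailOfSandwichSplit, PROVED in scratch: farm
rc 0, 0 sorry) turns them into UnitScaleTilt.HistoryTailL, and the shared residuals 19200/20520
close rung R3.
Lean: SandwichFractionalWindowTailL ∧ SandwichDeepWindowTailL ∧ HistoryTailOfSandwichSplit ∧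
MinimiserStabilityRegPr ∧ FluctuationComparisonRegPrIntL

CLOSES_TARGET: closes rung R3 of QuantumFields: Literature.MathematicalPhysics.QuantumFieldTheory.Balaban1983to89.T3YM3TorusStatement.YM3TorusSU2 (D-0061; not the summit Statement) — the deciding theorem of this route concludes that registered leaf instead of the Statement decl `YangMills` (class rung: servable and labelled, never counted as concluding the summit Statement).

Rationale: WHY THIS LINE. Rev 0 split the first-exit window tail of the averaged plaquette by depth and aimed a
Haar-exact covariant Cameron–Martin sweep at the fractional range (FractionalWindowTailL). The LEAD
of crux 19936 LOCATED the hazard (HAZARD-HGap-uniform-w1g6, kernel certificate ✓p658705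
`CovariantDischargeSweepNoGain.sum_cos_sub_circulation_le_zero`): a configuration with UNIFORM flux
(1+ε)θ/L^{2j} on a slab wider than the sweep's support lies in the plain window, is a critical point
of the Wilson action, and every compactly supported sweep has gain ≤ 0 there (Σ_p(da)_p = 0,
Jensen); the LEAD's §3 shows the first-order gain is f(P₀) − Σ_P c_P f(P) and the window does not
bound the far c-weighted mean. Rev 1 (lens «nearmiss»: measured deficit = that witness; single input
changed = the event) re-types the sweep's target as the SANDWICH event — finer heights θ(b)-small,
ALL CONSTRAINED COARSER heights θ(Λb)-small, level j θ(b)-bad — which (i) EXCLUDES the witnesses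
(uniform flux on a height-(j+t) block with L^{3t/2} > Λ is θ(Λb)-large), (ii) bounds the far mean by
Λθ(L^j/R)^{3/2} ≪ θ for the sweep truncated at R = L^{3j} inside the coarse-good range, and (iii)
costs NOTHING in the assembly: the complement of Bałaban's small-history event is covered EXACTLY by
sandwich pieces indexed by the MAXIMAL severity level k (U is θ(Λ^k b₀)-bad somewhere; finite since
dist1 ≤ 2) and the finest bad height — no window trick, no mass moved elsewhere — at the price of
constants uniform along the ladder b = Λ^k b₀ (absorbed: k ≤ C·m·(1+log β)). Imported:
[Balaban1985UV3] (7)/(71), [Balaban1985Averaging] Prop. 1, the rev-0 bricks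
✓p655612/p656090/p656573/p656965/p657255 (reweighting identity, direction net, gap reduction for
ARBITRARY events), [doi:10.1006/jfan.1997.3103] (Cameron–Martin/Driver on compact groups),
[doi:10.1007/bf01609854].
RANKED CRUXES. (2) SandwichFractionalWindowTailL — XL, the sweep's repaired target (skeleton
Lines/sandwich_discharge.lean: sandwichBoundedDepth PROVED by crude locality; the probabilistic
shell sandwichSweep_of_gap_large PROVED from the landed gap reduction ✓p657255;
stub_sandwichSweepGap OPEN = the DETERMINISTIC (HGap-sandwich) sweep-gap inequality with the
far-mean lemma, stub_sandwichLarge OPEN = crude regime θ(Λb) > 1; walls: covariant frame-defect sup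
j ≲ K/3, crude middle regime N₁ > 6 + 2·log_L 151). (3) SandwichDeepWindowTailL — RESIDUAL,
organ-class (deep constrained heights; ladder-uniform; not byte-implied by DeepWindowTailL and not
implying it). (5) FluctuationComparisonRegPrIntL, (6) MinimiserStabilityRegPr — shared residuals of
UnitScaleTilt. Support (9) HistoryTailOfSandwichSplit — PROVED in scratch (Theorems draft
CovariantDischargeHistoryTailOfSandwichSplit.lean, farm rc 0 / 0 sorry: severity-maximal re-cover,
severities summed without counting via emptiness above 2 ≥ dist1, per-height sums, bareTailAt);
lands on rev 1. Asides (banked): FractionalWindowTailL (hazard-dead for sweeps), DeepWindowTailL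
(cited by other routes), LevelOneWindowTailL ✓, HistoryTailOfSplit ✓.
KILL CRITERIA. (a) A window-compatible configuration INSIDE the sandwich event (coarse heights
θ(Λb)-small up to K − ⌊K/m⌋) on which every sweep supported in radius L^{3j} has gain ≤ 0 — e.g. a
non-uniform critical point of the Wilson action with small averaged curvature at all constrained
scales — kills stub_sandwichSweepGap exactly as ✓p658705 killed (HGap). (b) A proof that the
frame-defect sup cannot be made < 1 at any fixed fraction j = K/N₁ (colour-spiral saturation already
forces N₁ ≥ 3). (c) Refutation of ladder-uniformity: a profile b ≥ b₀ in the middle regime (b_s < b,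
Θ(b) < c″L^{−j}ρ) where neither sweep nor crude sup-Stokes applies for j = K/N₁ with every N₁.
NOT DECOMPOSED YET. stub_sandwichSweepGap splits naturally into (α) the far-mean lemma (coarse
θ(Λb)-smallness at heights j..3j ⇒ |Σ_P c_P f(P)| ≤ Λθ(L^j/R)^{3/2}, non-abelian averaging control
[Balaban1985Averaging]), (β) the truncated-sweep sure gap on the sandwich event minus (α), (γ) the
three-regime ladder uniformity; not filed as items before a prover asks (two layers only).
CHEAPEST FALSIFIER. Run the LEAD's KILL-TESTS-window-lines-w1g6 Test 1 (uniform excess) against the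
sandwich event: the witness must FAIL membership at height j+1 for Λ = 2, L ≥ 2 ((1+ε)L^{3/2} > 2);
then Test 2–4 of the same memo (multi-height towers, dipole pairs, colour spirals) for membership +
gain sign with R = L^{3j} — a one-page computation, no kit needed.

Novelty: Rev 1 («SeveritySandwich», 2026-08-29, after the LEAD's located hazard ✓p658705
`CovariantDischargeSweepNoGain`). Searches (this gen + g6 re-read): lit search --hybrid "large field
small field inductive bookkeeping severity levels renormalization group lattice gauge" →
[corpus:paper:magnen1993-cmp155-mrs-ym4-infrared-cutoff p.33–34] (MRS93: nested large/small-field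
regions per scale, axial gauge — bookkeeping of REGIONS in a cluster expansion, not an event-level
re-cover of a probability tail); lit galaxy search "large field|small field region|inductive
bookkeeping" --star pdf → [galaxy:pdf:4269152324782840500] (Dimock, arXiv:1108.1335–1212.5562
trilogy: small/large-field split inside an RG flow for φ⁴₃, again expansion-side); lit search
--hybrid "Cameron-Martin shift quasi-invariance lattice gauge theory Gibbs measure tail bound" and
lit vsearch "<Gaussian tail of a block-averaged plaquette via a Haar-preserving covariant
translation>" (g6: no lattice-gauge tail argument; nearest continuum: Driver
[corpus:paper:doi-10-1006-jfan-1997-3103 p.1,67,68]); lit search "McBryan Spencer complex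
translation" → doi:10.1007/bf01609854 (abelian, correlations not tails); galaxy
"Cameron-Martin|quasi-invariance" --star pdf, "uniform flux|constant field strength|critical point
Wilson action" --star pdf: no hits bearing on a sweep's far mean in corpus(fts+vec) and galaxy.
Tree: own rev 0 (`Lines/covariant_discharge.lean`, bricks ✓p655612…p657255), the LEAD's certificate
`Theorems/CovariantDi  [refs: 10.1007/bf01609854, 10.1006/jfan.1997.3103, 1108.1335, paper:magnen1993-cmp155-mrs-ym4-infrared-cutoff, paper:doi-10-1006-jfan-1997-3103, doi:10.1007/bf01609854, doi:10.1006/jfan.1997.3103]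

Barriers (technique_class: cameron-martin-sweep, deterministic-small-field, LF-ladder): - technique_class: cameron-martin-sweep, deterministic-small-field, LF-ladder (LF-ladder =
large-field severity ladder b_k = 2^k b₀)
- Literature.Barriers.QuantumFields.UVStabilityNonUniqueness: outside its class —
SandwichFractionalWindowTailL / SandwichDeepWindowTailL are fixed-cut-off tail bounds uniform in K
(and in the profile base b ≥ b₀) obtained by an exact change of variables + deterministic geometry,
not consequences of two-sided stability bounds (`IsUVStabilityConsequence`); uniqueness content
stays in the shared residuals 19200/20520.
- Literature.Barriers.QuantumFields.PerturbativeInvisibility: outside — no perturbative series is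
summed or truncated; the only expansions are the deterministic second-order Taylor bound of 1 − ½tr
on the sandwich event and the first-order gain f(P₀) − Σ_P c_P f(P).
- Literature.Barriers.QuantumFields.RegularisationDichotomy: Wilson action on Bałaban's tori as is;
no momentum cut-off.
- Literature.Barriers.QuantumFields.FixedCouplingUltralocality: does not apply — β_K → ∞ along the
scheme, no fixed-coupling continuum claim.
- Literature.Barriers.QuantumFields.StochasticQuantisationCriticality: does not apply — no dynamics,
no mixing time; the sweep is ONE deterministic pass, not a Markov chain.
- Tree certificate (not catalogued)
`Theorems/CovariantDischargeSweepNoGain.sum_cos_sub_circulation_le_zero` ✓p658705 (LEAD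
ym-ust-19936-w1 g6): every compactly supported sweep has gain ≤ 0 at a locally-uniform-flux
configuration of the PLAIN

sub-problem: YangMills · status: open · opened planner-ym-r3-idea-2-g6-0 2026-08-28T17:12:12Z · rev 3 · ledger route-QuantumFields-CovariantDischarge
GENERATED by the gate from the ledger (D-0016/17). Provers cite these decls: `theorem foo : Summit.QuantumFields.YangMills.Theses.CovariantDischarge.<Decl> := …` in Summits/QuantumFields/YangMills/Theorems/<Name>.lean.
-/

namespace Summit.QuantumFields.YangMills.Theses.CovariantDischarge

open scoped BigOperators Topology Manifold Classical MeasureTheory ProbabilityTheory Matrix InnerProductSpace ComplexConjugate ContinuousMap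
open Filter Set Function TopologicalSpace MeasureTheory

attribute [summit_statement] _root_.YangMills
attribute [summit_statement] _root_.Literature.MathematicalPhysics.QuantumFieldTheory.Balaban1983to89.T3YM3TorusStatement.YM3TorusSU2

/-- item stmt-QuantumFields-24186 · crux · rank 2 · closed · proved by Summit.QuantumFields.YangMills.Theorems.CovariantDischargeSandwichFractionalWindowTailL.sandwichFractionalWindowTailL_proof (prover) · by planner
why it might fail: Ladder-uniform constants need three regimes (sweep b ≤ b_s ≈ L^((K−3j)/2)/√γ; crude sup-Stokes for Θ ≥ c″L^(−j)ρ with N₁ > 6+2·log_L 151; empty pieces); the covariant frame-defect SUP p·p_K²L^(3j/2)/√β_K is saturated by colour-spiral fields (j ≲ K/3) and the far-mean lemma is non-abelian.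
sources: Balaban1985UV3, Balaban1985Averaging, doi:10.1006/jfan.1997.3103, doi:10.1007/bf01609854
[crux] SANDWICH FRACTIONAL WINDOW TAIL (repair of FractionalWindowTailL after the LEAD's located
hazard HAZARD-HGap-uniform-w1g6 / ✓p658705 CovariantDischargeSweepNoGain): for every L there is N₁ >
0 such that for every ladder base (b₀, p₀) and ratio Λ > 1 there are γ₁ ∈ (0,1], C, c > 0, N with —
UNIFORMLY over all profiles b ≥ b₀ — for every family F (F.L = L), 0 < γ ≤ γ₁, every run K with n
free top heights (the n of Bałaban's histGood θ K n), every height j with N₁·j + n ≤ K and every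
plaquette p of T^(j): Gibbs_K(all finer heights k < j θ(b)-small ∧ ALL CONSTRAINED COARSER heights j
≤ j' ≤ K − n θ(Λb)-small ∧ θ(b)(K−j) ≤ dist1(Ū^j(∂p))) ≤ C·β_(K−j)^N·exp(−c·p_(K−j)(b₀)²). Since K −
n ≥ N₁·j the θ(Λb)-good coarse range always reaches N₁× the bad height: the coarse conjunct EXCLUDES
the locally-uniform-excess configurations of ✓p658705 (uniform flux on a height-(j+t) block with
L^{3t/2} > Λ is θ(Λb)-LARGE) and bounds the far c-weighted mean of the LEAD's §3 by Λθ(L^j/R)^{3/2}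
for the sweep truncated at R = L^{3j}; the bounded-depth slice j ≤ j₀ is PROVED uniformly in b
(skeleton Lines/sandwich_discharge.lean `sandwichBoundedDepth`, crude locality
`perPlaquette_boundedHeight_unifo -/
@[route_item "route-QuantumFields-CovariantDischarge", crux]
def SandwichFractionalWindowTailL : Prop :=
  open Literature.MathematicalPhysics.QuantumFieldTheory.Balaban1983to89 Literature.MathematicalPhysics.QuantumFieldTheory.Balaban1983to89.T3ContinuumYM3Torus in ∀ (L : ℕ), ∃ N₁ : ℕ, 0 < N₁ ∧ ∀ (b₀ p₀ Λ : ℝ), 0 < b₀ → 2 < p₀ → 1 < Λ → ∃ (γ₁ C c : ℝ) (N : ℕ), 0 < γ₁ ∧ γ₁ ≤ 1 ∧ 0 < c ∧ ∀ (F : T3Family) (γ : ℝ), F.L = L → 0 < γ → γ ≤ γ₁ → ∀ (b : ℝ), b₀ ≤ b → ∀ (K n j : ℕ), N₁ * j + n ≤ K → ∀ p : Plaq (F.P K) j, (T3UnitScaleTilt.gibbsK F T3UnitLawDensityEML.ℰp γ K).real {U | (∀ k, k < j → PlaqSmall (T3UnitScaleTilt.θBal F.L γ b p₀ (K - k)) (Averaging.iter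 (fun i => BlockAveraging.blockAvg (P := F.P K) (j := i) T3UnitLawDensityEML.ℰp) k U)) ∧ (∀ j', j ≤ j' → j' + n ≤ K → PlaqSmall (T3UnitScaleTilt.θBal F.L γ (Λ * b) p₀ (K - j')) (Averaging.iter (fun i => BlockAveraging.blockAvg (P := F.P K) (j := i) T3UnitLawDensityEML.ℰp) j' U)) ∧ T3UnitScaleTilt.θBal F.L γ b p₀ (K - j) ≤ GaugeGroup.dist1 (GaugeField.plaqHol (Averaging.iter (fun i => BlockAveraging.blockAvg (P := F.P K) (j := i) T3UnitLawDensityEML.ℰp) j U) p)} ≤ C * ((γ * ((F.L : ℝ)⁻¹) ^ (K - j))⁻¹) ^ N * Real.exp (-(c * B10.pFun b₀ p₀ (Real.sqrt (γ * ((F.L : ℝ)⁻¹) ^ (K - j))) ^ 2))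

-- `SandwichFractionalWindowTailL` holds: proved by `Summit.QuantumFields.YangMills.Theorems.CovariantDischargeSandwichFractionalWindowTailL.sandwichFractionalWindowTailL_proof` (its module imports this route file, so no `_holds` link can be stated here).

/-- item stmt-QuantumFields-24187 · crux · rank 3 · open · by planner
why it might fail: At depth j ≥ K/2 a tower of marginally-large finer levels shifts Ū^j by ≳ r·θ (JOB B, ε*≈4.2·2^(−K)); the coarse conjunct does not help there and Gaussian strength at the unit scale is exactly Bałaban's unprinted large-field induction.
sources: Balaban1989LargeFieldII, Balaban1988Convergent, Balaban1985UV3, arXiv:1212.5562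
[crux] RESIDUAL (organ-class; replaces DeepWindowTailL on this route — NOT byte-implied by it and
not implying it: the event is SMALLER (coarse conjunct) but the constants are LADDER-UNIFORM in b ≥
b₀): for every L and N₁ > 0, every (b₀, p₀, Λ > 1) there are γ₁ ∈ (0,1], C, c > 0, N with, uniformly
over b ≥ b₀, for every F (F.L = L), 0 < γ ≤ γ₁, every run K with n ≥ 2 free top heights and every
DEEP constrained height 1 ≤ j, j + n ≤ K < N₁·j + n, every p: the same sandwich bound
C·β_(K−j)^N·exp(−c·p_(K−j)(b₀)²). Cut-off-uniform integration at depth Θ(K) = Bałaban's unprinted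
large-field induction [Balaban1989LargeFieldII]; nobody is asked to prove it on this route.
[difficulty: open-problem] -/
@[route_item "route-QuantumFields-CovariantDischarge", crux]
def SandwichDeepWindowTailL : Prop :=
  open Literature.MathematicalPhysics.QuantumFieldTheory.Balaban1983to89 Literature.MathematicalPhysics.QuantumFieldTheory.Balaban1983to89.T3ContinuumYM3Torus in ∀ (L N₁ : ℕ), 0 < N₁ → ∀ (b₀ p₀ Λ : ℝ), 0 < b₀ → 2 < p₀ → 1 < Λ → ∃ (γ₁ C c : ℝ) (N : ℕ), 0 < γ₁ ∧ γ₁ ≤ 1 ∧ 0 < c ∧ ∀ (F : T3Family) (γ : ℝ), F.L = L → 0 < γ → γ ≤ γ₁ → ∀ (b : ℝ), b₀ ≤ b → ∀ (K n j : ℕ), 1 ≤ j → 2 ≤ n → j + n ≤ K → K < N₁ * j + n → ∀ p : Plaq (F.P K) j, (T3UnitScaleTilt.gibbsK F T3UnitLawDensityEML.ℰp γ K).real {U | (∀ k, k < j → PlaqSmall (T3UnitScaleTilt.θBal F.L γ b p₀ (K - k)) (Averaging.iter (fun i => BlockAveraging.blockAvg (P := F.P K) (j := i) T3UnitLawDensityEML.ℰp)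 k U)) ∧ (∀ j', j ≤ j' → j' + n ≤ K → PlaqSmall (T3UnitScaleTilt.θBal F.L γ (Λ * b) p₀ (K - j')) (Averaging.iter (fun i => BlockAveraging.blockAvg (P := F.P K) (j := i) T3UnitLawDensityEML.ℰp) j' U)) ∧ T3UnitScaleTilt.θBal F.L γ b p₀ (K - j) ≤ GaugeGroup.dist1 (GaugeField.plaqHol (Averaging.iter (fun i => BlockAveraging.blockAvg (P := F.P K) (j := i) T3UnitLawDensityEML.ℰp) j U) p)} ≤ C * ((γ * ((F.L : ℝ)⁻¹) ^ (K - j))⁻¹) ^ N * Real.exp (-(c * B10.pFun b₀ p₀ (Real.sqrt (γ * ((F.L : ℝ)⁻¹) ^ (K - j))) ^ 2))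

/-- item stmt-QuantumFields-20520 · crux · rank 5 · open · by operator
why it might fail: Cross-cut-off content unprinted for non-abelian d=3: the King-slack two-run row at every co-height must come from the (α) record; a failure in the window's body is not rescued by any excision ratio c<1.
sources: Balaban1985UV3, King1986, Balaban1988Convergent, Balaban1989LargeFieldII
[crux] K1b-INT (E-INT interior excision of FluctuationComparisonRegPrL, OWNER RULING g22-№3 §B +
ADDENDUM 1; card C8 `edge-band-to-the-tail`): for every L there are an EXCISION RATIO 0 < c ≤ 1 and
THRESHOLDS (b₁, p₁) such that for every profile (b₀, p₀) with b₁ ≤ b₀, p₁ ≤ p₀, 0 < b₀, 2 < p₀ there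
is ε₁ > 0 such that for every 0 < ε₀ ≤ ε₁ there is m₀ such that for every m ≥ m₀ there is a
volume-uniform γ₁ > 0 such that for every T3Family F with F.L = L and 0 < γ ≤ γ₁,
`T3InteriorExcision.FluctuationComparisonRegPrIntAt F γ b₀ p₀ m c ε₀`: a.e. on the SHRUNK window
`PlaqSmall (θBal L γ (c·b₀) p₀ (K/m))` both restricted height densities of runs K and K+1 on the
histGood events at the ORIGINAL profile (b₀, p₀) are positive and log ρ + β·minActionRegPr of the
two runs agree modulo constants κ_K up to summable r_K (same body as FluctuationComparisonRegPrAt;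
only the a.e. guard is the c-window). FORMALLY WEAKER than FluctuationComparisonRegPrL (c = 1;
window monotone in b₀: `θBal_mono_b`), NO edge clause (the band {θ(c·b₀)-large, θ(b₀)-small} is
charged to HistoryTailL, whose profile floor absorbs the rescaling:
`T3InteriorExcision.unitTiltTail_of_interior`), and on the c-window print's χ -/
@[route_item "route-QuantumFields-CovariantDischarge", crux]
def FluctuationComparisonRegPrIntL : Prop :=
  open Literature.MathematicalPhysics.QuantumFieldTheory.Balaban1983to89 Literature.MathematicalPhysics.QuantumFieldTheory.Balaban1983to89.T3ContinuumYM3Torus in ∀ (L : ℕ), ∃ (c b₁ p₁ : ℝ), 0 < c ∧ c ≤ 1 ∧ ∀ (b₀ p₀ : ℝ), b₁ ≤ b₀ → p₁ ≤ p₀ → 0 < b₀ → 2 < p₀ → ∃ ε₁ : ℝ, 0 < ε₁ ∧ ∀ (ε₀ : ℝ), 0 < ε₀ → ε₀ ≤ ε₁ → ∃ m₀ : ℕ, ∀ (m : ℕ), m₀ ≤ m → ∃ γ₁ : ℝ, 0 < γ₁ ∧ ∀ (F : T3Family) (γ : ℝ), F.L = L → 0 < γ → γ ≤ γ₁ → T3InteriorExcision.FluctuationComparisonRegPrIntAt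 F γ b₀ p₀ m c ε₀

/-- item stmt-QuantumFields-19200 · crux · rank 6 · open · by operator
why it might fail: Uniformly over all small V the errors along the printed minimiser (interpolation ≈ B₃²b₀²p(g)²L^(K(5/m−2)), cubic averaging error) must be summable, m ≥ 3; INTERP unprinted, AVG-INEQ printed only for Federbush's averaging.
sources: Balaban1985UV3, King1986
[crux] K1aR-pr (E-min at the minimum over PRINT'S regular space (6) of Balaban1985Variational IN
FULL — both clauses of (2): small plaquette variables AND small covariant divergence
Balaban1985RegularSpaces (1.9); replaces MinimiserStability stmt-QuantumFields-19822; supersedes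
children-v2's plaquette-only MinimiserStabilityReg, which needed the unprinted gap G-K1aR-1 on top
of [7] Thm 1) — for every block size L there is ε₁(L) > 0 (the uniqueness radius a₀ of
Balaban1985Variational Thm 1, «depends on d and L only») such that for every 0 < ε₀ ≤ ε₁, all
sufficiently large m ≥ m₀(L, ε₀), every profile (b₀, p₀) and all 0 < γ ≤ γ₁(L, ε₀, m, b₀, p₀), every
T3Family F with F.L = L: `MinimiserStabilityRegPrAt F γ b₀ p₀ m ε₀` (tree module
`T3PrintedRegularMinimiser` = `BgStabilityAt` at the printed backgrounds `bgRegPr`/`bgRegPr'`) —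
summable r_K ≥ 0 and constants κ_K with, for every K and EVERY θBal(⌊K/m⌋)-small field V on the
comparison lattice, |β_{K+1}·minActionRegPr_{K+1}(V) − β_K·minActionRegPr_K(V) − κ_K| ≤ r_K (κ
idle), where minActionRegPr_K(V) = inf of the Wilson action over run K's fibre of V ∩ {|U(∂p) − 1| <
ε₀L^{-2(K−⌊K/m⌋)} ∀p} ∩ {‖(D^{1*}_U ∂U)(b)‖ < ε₀L^{-3(K−⌊K/m⌋)} ∀b} (d -/
@[route_item "route-QuantumFields-CovariantDischarge", crux]
def MinimiserStabilityRegPr : Prop :=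
  open Literature.MathematicalPhysics.QuantumFieldTheory.Balaban1983to89 Literature.MathematicalPhysics.QuantumFieldTheory.Balaban1983to89.T3ContinuumYM3Torus in ∀ (L : ℕ), ∃ ε₁ : ℝ, 0 < ε₁ ∧ ∀ (ε₀ : ℝ), 0 < ε₀ → ε₀ ≤ ε₁ → ∃ m₀ : ℕ, ∀ (m : ℕ), m₀ ≤ m → ∀ (b₀ p₀ : ℝ), 0 < b₀ → 2 < p₀ → ∃ γ₁ : ℝ, 0 < γ₁ ∧ ∀ (F : T3Family) (γ : ℝ), F.L = L → 0 < γ → γ ≤ γ₁ → T3PrintedRegularMinimiser.MinimiserStabilityRegPrAt F γ b₀ p₀ m ε₀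

/-- item stmt-QuantumFields-22891 · aside · rank 2 · open · by planner
why it might fail: The frame-defect sum Σ_p β(da)_p·M_p·|F_p| is bounded deterministically only while p²p_K³L^(3j) ≲ √β_K (tree frames) or p·p_K²L^(3j/2)log N ≲ √β_K (covariant frames); if expMeanLog transport mismatch costs L^(2j)θ_K·θ_h per unit, N₁ must exceed 4 and constants may leak K.
sources: Balaban1985UV3, Balaban1985Averaging, doi:10.1006/jfan.1997.3103, doi:10.1007/bf01609854
[crux] For every L there is N₁ > 0 such that for all profiles (b₀, p₀, b₂) (0 < b₀, 2 < p₀, b₀ ≤ b₂)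
there are γ₁ ∈ (0,1], C, c > 0, N with: for every T3Family F (F.L = L), 0 < γ ≤ γ₁, every K and
every level 2 ≤ j with N₁·j ≤ K, every plaquette p of T^(j): Gibbs_K(all finer levels k < j
θ(b₀)-small ∧ level j θ(b₂)-small ∧ θ(b₀)(K−j) ≤ dist1(Ū^j(∂p))) ≤ C·β_(K−j)^N·exp(−c·p(g_(K−j))²) —
the window schema of stmt-26243 on a positive FRACTION of the depth. [deps: LevelOneWindowTailL]
[difficulty: XL] -/
@[route_item "route-QuantumFields-CovariantDischarge", crux]
def FractionalWindowTailL : Prop :=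
  open Literature.MathematicalPhysics.QuantumFieldTheory.Balaban1983to89 Literature.MathematicalPhysics.QuantumFieldTheory.Balaban1983to89.T3ContinuumYM3Torus in ∀ (L : ℕ), ∃ N₁ : ℕ, 0 < N₁ ∧ ∀ (b₀ p₀ b₂ : ℝ), 0 < b₀ → 2 < p₀ → b₀ ≤ b₂ → ∃ (γ₁ C c : ℝ) (N : ℕ), 0 < γ₁ ∧ γ₁ ≤ 1 ∧ 0 < c ∧ ∀ (F : T3Family) (γ : ℝ), F.L = L → 0 < γ → γ ≤ γ₁ → ∀ (K j : ℕ), 2 ≤ j → N₁ * j ≤ K → ∀ p : Plaq (F.P K) j, (T3UnitScaleTilt.gibbsK F T3UnitLawDensityEML.ℰp γ K).real {U | (∀ k, k < j → PlaqSmall (T3UnitScaleTilt.θBal F.L γ b₀ p₀ (K - k)) (Averaging.iter (fun i => BlockAveraging.blockAvg (P := F.P K) (j := i) T3UnitLawDensityEML.ℰp) k U)) ∧ PlaqSmall (T3UnitScaleTilt.θBal F.L γ b₂ p₀ (K - j)) (Averaging.iter (fun i => BlockAveraging.blockAvg (P := F.P K) (j := i) T3UnitLawDensityEML.ℰp) j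 U) ∧ T3UnitScaleTilt.θBal F.L γ b₀ p₀ (K - j) ≤ GaugeGroup.dist1 (GaugeField.plaqHol (Averaging.iter (fun i => BlockAveraging.blockAvg (P := F.P K) (j := i) T3UnitLawDensityEML.ℰp) j U) p)} ≤ C * ((γ * ((F.L : ℝ)⁻¹) ^ (K - j))⁻¹) ^ N * Real.exp (-(c * B10.pFun b₀ p₀ (Real.sqrt (γ * ((F.L : ℝ)⁻¹) ^ (K - j))) ^ 2))

/-- item stmt-QuantumFields-22892 · aside · rank 3 · open · by planner
why it might fail: At depth j ≥ K/2 a tower of marginally-large finer levels shifts Ū^j by ≳ r·θ and bare fibre convexity is measured dead (JOB B, ε*≈4.2·2^(−K)); Gaussian strength there is exactly Bałaban's unprinted large-field induction [Balaban1989LargeFieldII].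
sources: Balaban1989LargeFieldII, Balaban1988Convergent, Balaban1985UV3, arXiv:1212.5562
[crux] RESIDUAL (organ-class; implied verbatim by stmt-26243): for every L and every N₁ > 0, the
same window schema for the DEEP levels 1 ≤ j ≤ K with K < N₁·j (constants may depend on N₁).
[difficulty: open-problem] -/
@[route_item "route-QuantumFields-CovariantDischarge", crux]
def DeepWindowTailL : Prop :=
  open Literature.MathematicalPhysics.QuantumFieldTheory.Balaban1983to89 Literature.MathematicalPhysics.QuantumFieldTheory.Balaban1983to89.T3ContinuumYM3Torus in ∀ (L N₁ : ℕ), 0 < N₁ → ∀ (b₀ p₀ b₂ : ℝ), 0 < b₀ → 2 < p₀ → b₀ ≤ b₂ → ∃ (γ₁ C c : ℝ) (N : ℕ), 0 < γ₁ ∧ γ₁ ≤ 1 ∧ 0 < c ∧ ∀ (F : T3Family) (γ : ℝ), F.L = L → 0 < γ → γ ≤ γ₁ → ∀ (K j : ℕ), 1 ≤ j → j ≤ K → K < N₁ * j → ∀ p : Plaq (F.P K) j, (T3UnitScaleTilt.gibbsK F T3UnitLawDensityEML.ℰp γ K).real {U | (∀ k, k < j → PlaqSmall (T3UnitScaleTilt.θBal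 F.L γ b₀ p₀ (K - k)) (Averaging.iter (fun i => BlockAveraging.blockAvg (P := F.P K) (j := i) T3UnitLawDensityEML.ℰp) k U)) ∧ PlaqSmall (T3UnitScaleTilt.θBal F.L γ b₂ p₀ (K - j)) (Averaging.iter (fun i => BlockAveraging.blockAvg (P := F.P K) (j := i) T3UnitLawDensityEML.ℰp) j U) ∧ T3UnitScaleTilt.θBal F.L γ b₀ p₀ (K - j) ≤ GaugeGroup.dist1 (GaugeField.plaqHol (Averaging.iter (fun i => BlockAveraging.blockAvg (P := F.P K) (j := i) T3UnitLawDensityEML.ℰp) j U) p)} ≤ C * ((γ * ((F.L : ℝ)⁻¹) ^ (K - j))⁻¹) ^ N * Real.exp (-(c * B10.pFun b₀ p₀ (Real.sqrt (γ * ((F.L : ℝ)⁻¹) ^ (K - j))) ^ 2))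

/-- item stmt-QuantumFields-22894 · aside · rank 4 · closed · proved by Summit.QuantumFields.YangMills.Theorems.CovariantDischargeBoundedDepthWindowTail.levelOneWindowTailL_proof (prover) · by planner
why it might fail: Even at j = 1 the Hodge-exact background has dipole tails over the whole torus; truncating at radius R = p·p_K·L^(3/2) leaves a spurious current bounded by 1 only if the toron/harmonic part of w is ≤ g_h/p, which needs √γ·L^((3−K)/2)·p·p_K² ≤ 1 — γ₁ must absorb small K.
sources: Balaban1985UV3, Balaban1985Averaging, doi:10.1006/jfan.1997.3103
[crux] FIRST RUNG (the lever's cheapest honest instance): for every L and profile (b₀, p₀, b₂) there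
are γ₁ ∈ (0,1], C, c > 0, N with, for every F (F.L = L), 0 < γ ≤ γ₁, every K ≥ 1 and every plaquette
p of T^(1): Gibbs_K(bare level θ(b₀)(K)-small ∧ level 1 θ(b₂)(K−1)-small ∧ θ(b₀)(K−1) ≤
dist1(Ū^1(∂p))) ≤ C·β_(K−1)^N·exp(−c·p(g_(K−1))²) — Gaussian tail of the ONCE-averaged SU(2)
plaquette, uniformly in the cut-off. [difficulty: L] -/
@[route_item "route-QuantumFields-CovariantDischarge", crux]
def LevelOneWindowTailL : Prop :=
  open Literature.MathematicalPhysics.QuantumFieldTheory.Balaban1983to89 Literature.MathematicalPhysics.QuantumFieldTheory.Balaban1983to89.T3ContinuumYM3Torus in ∀ (L : ℕ), ∀ (b₀ p₀ b₂ : ℝ), 0 < b₀ → 2 < p₀ → b₀ ≤ b₂ → ∃ (γ₁ C c : ℝ) (N : ℕ), 0 < γ₁ ∧ γ₁ ≤ 1 ∧ 0 < c ∧ ∀ (F : T3Family) (γ : ℝ), F.L = L → 0 < γ → γ ≤ γ₁ → ∀ (K j : ℕ), j = 1 → 1 ≤ K → ∀ p : Plaq (F.P K) j, (T3UnitScaleTilt.gibbsK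 F T3UnitLawDensityEML.ℰp γ K).real {U | (∀ k, k < j → PlaqSmall (T3UnitScaleTilt.θBal F.L γ b₀ p₀ (K - k)) (Averaging.iter (fun i => BlockAveraging.blockAvg (P := F.P K) (j := i) T3UnitLawDensityEML.ℰp) k U)) ∧ PlaqSmall (T3UnitScaleTilt.θBal F.L γ b₂ p₀ (K - j)) (Averaging.iter (fun i => BlockAveraging.blockAvg (P := F.P K) (j := i) T3UnitLawDensityEML.ℰp) j U) ∧ T3UnitScaleTilt.θBal F.L γ b₀ p₀ (K - j) ≤ GaugeGroup.dist1 (GaugeField.plaqHol (Averaging.iter (fun i => BlockAveraging.blockAvg (P := F.P K) (j := i) T3UnitLawDensityEML.ℰp) j U) p)} ≤ C * ((γ * ((F.L : ℝ)⁻¹) ^ (K - j))⁻¹) ^ N * Real.exp (-(c * B10.pFun b₀ p₀ (Real.sqrt (γ * ((F.L : ℝ)⁻¹) ^ (K - j))) ^ 2))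

-- `LevelOneWindowTailL` holds: proved by `Summit.QuantumFields.YangMills.Theorems.CovariantDischargeBoundedDepthWindowTail.levelOneWindowTailL_proof` (its module imports this route file, so no `_holds` link can be stated here).

/-- item stmt-QuantumFields-22895 · aside · rank 9 · closed · proved by Summit.QuantumFields.YangMills.Theorems.covariantDischarge_historyTailOfSplit_proof (planner) · by planner
sources: Balaban1985UV3, King1986
[support] THE GLUE (PROVED in Sketch.lean, `historyTailOfSplit_proof`, to be landed as
Theorems/CovariantDischargeHistoryTailOfSplit.lean right after open): LevelOneWindowTailL →
FractionalWindowTailL → DeepWindowTailL → the body of UnitScaleTilt.HistoryTailL. Take N₁ from X₂,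
instantiate X₃ at N₁, merge constants (γ₁ = min, C = Σ|C_i|, c = min, N = Σ N_i; β_(K−j) = L^(K−j)/γ
≥ 1) to get FirstExitWindow.FirstExitWindowTailL, then the landed
`unitScaleTilt_historyTailL_of_firstExitWindowTailL`. [difficulty: provable-now] -/
@[route_item "route-QuantumFields-CovariantDischarge"]
def HistoryTailOfSplit : Prop :=
  open Literature.MathematicalPhysics.QuantumFieldTheory.Balaban1983to89 Literature.MathematicalPhysics.QuantumFieldTheory.Balaban1983to89.T3ContinuumYM3Torus in LevelOneWindowTailL → FractionalWindowTailL → DeepWindowTailL → ∀ (L : ℕ) (b₁ p₁ : ℝ), ∃ (b₀ p₀ : ℝ), b₁ ≤ b₀ ∧ p₁ ≤ p₀ ∧ 0 < b₀ ∧ 2 < p₀ ∧ ∀ (m : ℕ), 0 < m → ∃ γ₁ : ℝ, 0 < γ₁ ∧ ∀ (F : T3Family) (γ : ℝ), F.L = L → 0 < γ → γ ≤ γ₁ → T3UnitScaleTilt.HistoryTailAt F γ b₀ p₀ m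

-- `HistoryTailOfSplit` holds: proved by `Summit.QuantumFields.YangMills.Theorems.covariantDischarge_historyTailOfSplit_proof` (its module imports this route file, so no `_holds` link can be stated here).

/-- item stmt-QuantumFields-24188 · support · rank 9 · closed · proved by Summit.QuantumFields.YangMills.Theorems.covariantDischarge_historyTailOfSandwichSplit_proof (planner) · by planner
sources: Balaban1985UV3, King1986
[support] THE SANDWICH DOOR — PROVED in the planner's scratch (bc/door.lean = Theorems draft
`CovariantDischargeHistoryTailOfSandwichSplit.lean`, farm rc 0, 0 sorry; lands as
`covariantDischarge_historyTailOfSandwichSplit_proof` the moment rev 1 carries the decl):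
SandwichFractionalWindowTailL → SandwichDeepWindowTailL → the body of UnitScaleTilt.HistoryTailL.
Proof: b₀ := max b₁ 1, p₀ := max p₁ 3, Λ := 2, γ₁ := min; SEVERITY-MAXIMAL SANDWICH RE-COVER (ladder
b_k = 2^k b₀, θ_k = 2^k θ_{b₀} by OneStepWindowL.θBal_const_mul; k := the maximal severity with U ∉
histGood θ_k K n — a ceiling exists since 2^{k₀}θ_{b₀} > 2 ≥ dist1 on SU(2); j := finest θ_k-bad
constrained height; maximality ⇒ all constrained heights ≥ j are θ_{k+1} = θ(2b_k)-small; j = 0 ⇒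
bare level), severities summed WITHOUT counting (piece k empty once 2^k θ_{b₀}(K−j) > 2 ⇒ Σ_k ≤
4B/θ_{b₀} ≤ 4B·β: one extra power of β), plaquettes/heights by
HistoryTailOfTwoSided.exists_perHeight_bound + geometric_profile, bare level by
T3BareTailProfile.bareTailAt, runs K, K+1 at n = ⌊K/m⌋. -/
@[route_item "route-QuantumFields-CovariantDischarge", crux]
def HistoryTailOfSandwichSplit : Prop :=
  open Literature.MathematicalPhysics.QuantumFieldTheory.Balaban1983to89 Literature.MathematicalPhysics.QuantumFieldTheory.Balaban1983to89.T3ContinuumYM3Torus in SandwichFractionalWindowTailL → SandwichDeepWindowTailL → ∀ (L : ℕ) (b₁ p₁ : ℝ), ∃ (b₀ p₀ : ℝ), b₁ ≤ b₀ ∧ p₁ ≤ p₀ ∧ 0 < b₀ ∧ 2 < p₀ ∧ ∀ (m : ℕ), 0 < m → ∃ γ₁ : ℝ, 0 < γ₁ ∧ ∀ (F : T3Family) (γ : ℝ), F.L = L → 0 < γ → γ ≤ γ₁ → T3UnitScaleTilt.HistoryTailAt F γ b₀ p₀ m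

-- `HistoryTailOfSandwichSplit` holds: proved by `Summit.QuantumFields.YangMills.Theorems.covariantDischarge_historyTailOfSandwichSplit_proof` (its module imports this route file, so no `_holds` link can be stated here).

/-- item stmt-QuantumFields-22896 · assembly · rank 1 · closed · proved by Summit.QuantumFields.YangMills.Theorems.CovariantDischarge.covariantDischarge_assembly_proof (prover) · by planner
sources: Balaban1985UV3, King1986
[assembly] MinimiserStabilityRegPr → FluctuationComparisonRegPrIntL → LevelOneWindowTailL →
FractionalWindowTailL → DeepWindowTailL → HistoryTailOfSplit → the leaf YM3TorusSU2 (rung R3; not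
the summit Statement). -/
@[route_item "route-QuantumFields-CovariantDischarge"]
def Assembly : Prop :=
  MinimiserStabilityRegPr → FluctuationComparisonRegPrIntL → LevelOneWindowTailL → FractionalWindowTailL → DeepWindowTailL → HistoryTailOfSplit → Literature.MathematicalPhysics.QuantumFieldTheory.Balaban1983to89.T3YM3TorusStatement.YM3TorusSU2

-- `Assembly` holds: proved by `Summit.QuantumFields.YangMills.Theorems.CovariantDischarge.covariantDischarge_assembly_proof` (its module imports this route file, so no `_holds` link can be stated here).

/-! D-0027 §2.1 — DECIDING THEOREM (planner-authored via `route open/edit --closes-file`; by planner-ym-r3-idea-2-g13-0 2026-08-29T06:58:24Z):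
its hypotheses are this route's items and its conclusion the registered leaf `Literature.MathematicalPhysics.QuantumFieldTheory.Balaban1983to89.T3YM3TorusStatement.YM3TorusSU2` (rung R3, D-0061) (glue_lint), and it elaborates with this file. -/

@[closes "route-QuantumFields-CovariantDischarge"] theorem closes (h200 : MinimiserStabilityRegPr) (h201 : FluctuationComparisonRegPrIntL)
    (hSF : SandwichFractionalWindowTailL) (hSD : SandwichDeepWindowTailL) (hG : HistoryTailOfSandwichSplit) :
    Literature.MathematicalPhysics.QuantumFieldTheory.Balaban1983to89.T3YM3TorusStatement.YM3TorusSU2 :=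
  Summit.QuantumFields.YangMills.Theses.UnitScaleTilt.closes h200 h201 (hG hSF hSD)

end Summit.QuantumFields.YangMills.Theses.CovariantDischarge
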